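import Summits.HodgeConjecture.CorCM.TwoGroupExtraspecialTable
import HarnessLib

/-!
# The table of `(C₈ × C₂)·2` with `θ(a) = a^μ`, `θ(u) = u a⁴`: centraliser of an involution with two conjugates, exponent-`8` case

COR-CM (cell `pub-hodgecm2`), binder seat b04 (gen 36), count-neutral own lane «Galois-CM-type classification».  KERNEL ONLY:
theorems; no definition, no named fact, no `sorry`.  Pure group theory for «case A» of the ORDER-`32` BASE programme (A7-JUNCTION
gen-36 addendum §F, family IA8): `|G| = 32`, `a` of order `8`, `u` an involution commuting with `a`, `u ∉ ⟨a⟩` (so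
`A = ⟨a⟩ × ⟨u⟩ ≅ C₈ × C₂`), `x ∉ A` with `x a = a^μ x`, `x u = a⁴ u x` (the involution `u` has the two conjugates `u, u a⁴`) and
`x² = a^σ u^τ`.  The word map `(i, j, k) ↦ aⁱ uʲ xᵏ` inverts to a table model `e : G ≃ ℤ/8 × 𝔽₂ × 𝔽₂` carrying the multiplication to
`(i,j,k)(i',j',k') = (i + μᵏ i' + 4kj' + kk'σ, j + j' + kk'τ, k + k')` (`exists_table_c8c2_action`; the law is passed by its four
`(k,k')`-cases, the unit and left-inverse identities as hypotheses decided at the parameters).  The groups: census #14 (`D₄ ∘ C₈`,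
`μ = 1, 5`), #24, #46 and `M₃₂`-like members — `CorCM/GaloisThirtyTwoCaseACertificatesA` decides their certificates.

## References

* [Rotman1995] J. J. Rotman, *An Introduction to the Theory of Groups*, 4th ed., GTM 148, Ch. 5 (extensions with cyclic kernel).
* [Shimura1998] G. Shimura, *Abelian Varieties with Complex Multiplication and Modular Functions*, §8.2.
-/

namespace Summit.HodgeConjecture.CorCM.GaloisModels.CyclicEightTimesTwo

open Summit.HodgeConjecture.CorCM.GaloisTableLaws
open Summit.HodgeConjecture.CorCM.GaloisModels.FrattiniTwo (exists_table_equiv_of_words_inv)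

variable {G : Type*} [Group G]

/-! ## §1 Collection rules -/

/-- `x a = a^m x` ⟹ `x aⁿ R = a^{mn} (x R)`. [folklore] -/
theorem act_pow_tail {a x : G} {m : ℕ} (hxa : x * a = a ^ m * x) (n : ℕ) (R : G) :
    x * (a ^ n * R) = a ^ (m * n) * (x * R) := by
  induction n generalizing R with
  | zero => simp
  | succ n ih =>
    rw [pow_succ, mul_assoc (a ^ n), ih (a * R), ← mul_assoc x a R, hxa, Nat.mul_succ, pow_add]
    simp only [mul_assoc]

/-- `x u = a⁴ u x` with `u a = a u` ⟹ `x uⁿ R = a^{4n} (uⁿ (x R))`. [folklore] -/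
theorem act_invol_pow_tail {a u x : G} (hua : u * a = a * u) (hxu : x * u = a ^ 4 * u * x) (n : ℕ) (R : G) :
    x * (u ^ n * R) = a ^ (4 * n) * (u ^ n * (x * R)) := by
  induction n generalizing R with
  | zero => simp
  | succ n ih =>
    have hc : Commute (a ^ 4) (u ^ n) := ((show Commute u a from hua).symm.pow_left 4).pow_right n
    rw [pow_succ, mul_assoc (u ^ n), ih (u * R), ← mul_assoc x u R, hxu, Nat.mul_succ, pow_add]
    simp only [mul_assoc]
    rw [hc.symm.left_comm]

/-- Commuting powers pass: `uᵐ (aⁿ R) = aⁿ (uᵐ R)`. [folklore] -/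
theorem comm_pow_tail {a u : G} (hua : u * a = a * u) (m n : ℕ) (R : G) :
    u ^ m * (a ^ n * R) = a ^ n * (u ^ m * R) :=
  ((show Commute u a from hua).pow_pow m n).left_comm R

/-! ## §2 The table model -/

variable [Finite G]

/-- **Table model for `(C₈ × C₂)·2`, `θ(a) = a^μ`, `θ(u) = u a⁴`, `x² = a^σ u^τ`.**  `|G| = 32`, `orderOf a = 8`, `u² = 1`,
`u a = a u`, `u ∉ ⟨a⟩`, `x ≠ aⁱ uʲ`, `x a = a^μ x`, `x u = a⁴ u x`, `x x = a^σ u^τ`; `mul` an operation on `ℤ/8 × 𝔽₂ × 𝔽₂` given by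
its four `(k, k')`-cases, with `mul p 0 = p` and a left inverse `inv`.  Then `e : G ≃ ℤ/8 × 𝔽₂ × 𝔽₂` with `e(gh) = mul (e g) (e h)` and
`e (aⁱ uʲ xᵏ) = (i, j, k)`. [cite: Rotman1995, Ch. 5] -/
theorem exists_table_c8c2_action {a u x : G} (μ σ : ZMod 8) (τ : ZMod 2) (ha : orderOf a = 8) (huu : u * u = 1)
    (hua : u * a = a * u) (hu : u ∉ Subgroup.zpowers a) (hx : ∀ i j : ℕ, x ≠ a ^ i * u ^ j)
    (hxa : x * a = a ^ μ.val * x) (hxu : x * u = a ^ 4 * u * x) (hxx : x * x = a ^ σ.val * u ^ τ.val)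
    (hcard : Nat.card G = 32)
    (mul : ZMod 8 × ZMod 2 × ZMod 2 → ZMod 8 × ZMod 2 × ZMod 2 → ZMod 8 × ZMod 2 × ZMod 2)
    (h00 : ∀ (i : ZMod 8) (j : ZMod 2) (i' : ZMod 8) (j' : ZMod 2), mul (i, j, 0) (i', j', 0) = (i + i', j + j', 0))
    (h01 : ∀ (i : ZMod 8) (j : ZMod 2) (i' : ZMod 8) (j' : ZMod 2), mul (i, j, 0) (i', j', 1) = (i + i', j + j', 1))
    (h10 : ∀ (i : ZMod 8) (j : ZMod 2) (i' : ZMod 8) (j' : ZMod 2),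
      mul (i, j, 1) (i', j', 0) = (i + μ * i' + 4 * (j'.val : ZMod 8), j + j', 1))
    (h11 : ∀ (i : ZMod 8) (j : ZMod 2) (i' : ZMod 8) (j' : ZMod 2),
      mul (i, j, 1) (i', j', 1) = (i + μ * i' + 4 * (j'.val : ZMod 8) + σ, j + j' + τ, 0))
    (inv : ZMod 8 × ZMod 2 × ZMod 2 → ZMod 8 × ZMod 2 × ZMod 2)
    (ho : ∀ p : ZMod 8 × ZMod 2 × ZMod 2, mul p (0, 0, 0) = p)
    (hlinv : ∀ p q : ZMod 8 × ZMod 2 × ZMod 2, mul (inv p) (mul p q) = q) :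
    ∃ e : G ≃ ZMod 8 × ZMod 2 × ZMod 2, (∀ g h : G, e (g * h) = mul (e g) (e h)) ∧
      ∀ p : ZMod 8 × ZMod 2 × ZMod 2, e (a ^ p.1.val * u ^ p.2.1.val * x ^ p.2.2.val) = p := by
  have hv0 : (0 : ZMod 2).val = 0 := rfl
  have hv1 : (1 : ZMod 2).val = 1 := rfl
  have ha8 : a ^ 8 = 1 := by rw [← ha]; exact pow_orderOf_eq_one a
  have hapow : ∀ m n : ℕ, m % 8 = n % 8 → a ^ m = a ^ n := fun m n h => pow_eq_pow_of_mod_eq a ha8 h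
  have hupow : ∀ m n : ℕ, m % 2 = n % 2 → u ^ m = u ^ n := fun m n h =>
    pow_eq_pow_of_mod_eq u (n := 2) (by rw [pow_two, huu]) h
  -- collection rules
  have XA : ∀ (n : ℕ) (R : G), x * (a ^ n * R) = a ^ (μ.val * n) * (x * R) := act_pow_tail hxa
  have XA' : ∀ n : ℕ, x * a ^ n = a ^ (μ.val * n) * x := fun n => by
    have h := XA n 1; simp only [mul_one] at h; exact h
  have XU : ∀ (n : ℕ) (R : G), x * (u ^ n * R) = a ^ (4 * n) * (u ^ n * (x * R)) := act_invol_pow_tail hua hxu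
  have XU' : ∀ n : ℕ, x * u ^ n = a ^ (4 * n) * (u ^ n * x) := fun n => by
    have h := XU n 1; simp only [mul_one] at h; exact h
  have UA : ∀ (m n : ℕ) (R : G), u ^ m * (a ^ n * R) = a ^ n * (u ^ m * R) := comm_pow_tail hua
  have UA' : ∀ m n : ℕ, u ^ m * a ^ n = a ^ n * u ^ m := fun m n => ((show Commute u a from hua).pow_pow m n).eq
  have AA : ∀ (m n : ℕ) (R : G), a ^ m * (a ^ n * R) = a ^ (m + n) * R := fun m n R => by rw [← mul_assoc, ← pow_add]
  have AA' : ∀ m n : ℕ, a ^ m * a ^ n = a ^ (m + n) := fun m n => (pow_add a m n).symm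
  have UU : ∀ (m n : ℕ) (R : G), u ^ m * (u ^ n * R) = u ^ (m + n) * R := fun m n R => by rw [← mul_assoc, ← pow_add]
  have UU' : ∀ m n : ℕ, u ^ m * u ^ n = u ^ (m + n) := fun m n => (pow_add u m n).symm
  -- values of sums in `ZMod 8` / `ZMod 2`
  have hvμ : ∀ i' : ZMod 8, (μ * i').val % 8 = μ.val * i'.val % 8 := fun i' => by rw [ZMod.val_mul]; exact Nat.mod_mod _ _
  have hv4 : ∀ j' : ZMod 2, (4 * (j'.val : ZMod 8)).val % 8 = 4 * j'.val % 8 := fun j' => by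
    rw [ZMod.val_mul, ZMod.val_natCast]
    have : (4 : ZMod 8).val = 4 := rfl
    rw [this]; simp [Nat.mul_mod]
  set f : ZMod 8 × ZMod 2 × ZMod 2 → G := fun p => a ^ p.1.val * u ^ p.2.1.val * x ^ p.2.2.val with hf_def
  have hf : ∀ p q, f (mul p q) = f p * f q := by
    rintro ⟨i, j, k⟩ ⟨i', j', k'⟩
    rcases zmod2_cases k with rfl | rfl <;> rcases zmod2_cases k' with rfl | rfl
    · rw [h00]
      simp only [hf_def, hv0, pow_zero, mul_one]
      simp only [mul_assoc, UA, AA, UU']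
      refine congrArg₂ (· * ·) (hapow _ _ ?_) (hupow _ _ ?_)
      · rw [ZMod.val_add]; omega
      · rw [ZMod.val_add]; omega
    · rw [h01]
      simp only [hf_def, hv0, hv1, pow_zero, pow_one, mul_one]
      simp only [mul_assoc, UA, AA, UU]
      refine congrArg₂ (· * ·) (hapow _ _ ?_) (congrArg₂ (· * ·) (hupow _ _ ?_) rfl)
      · rw [ZMod.val_add]; omega
      · rw [ZMod.val_add]; omega
    · rw [h10]
      simp only [hf_def, hv0, hv1, pow_zero, pow_one, mul_one]
      simp only [mul_assoc, XA, XU', UA, AA, UU]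
      refine congrArg₂ (· * ·) (hapow _ _ ?_) (congrArg₂ (· * ·) (hupow _ _ ?_) rfl)
      · have h1 := hvμ i'; have h2 := hv4 j'
        rw [ZMod.val_add, ZMod.val_add]
        generalize (μ * i').val = M at h1 ⊢; generalize μ.val * i'.val = M' at h1 ⊢
        generalize (4 * (j'.val : ZMod 8)).val = F at h2 ⊢
        omega
      · rw [ZMod.val_add]; omega
    · rw [h11]
      simp only [hf_def, hv0, hv1, pow_zero, pow_one, mul_one]
      simp only [mul_assoc, XA, XU, UA, AA, UU', hxx]
      refine congrArg₂ (· * ·) (hapow _ _ ?_) (hupow _ _ ?_)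
      · have h1 := hvμ i'; have h2 := hv4 j'
        rw [ZMod.val_add, ZMod.val_add, ZMod.val_add]
        generalize (μ * i').val = M at h1 ⊢; generalize μ.val * i'.val = M' at h1 ⊢
        generalize (4 * (j'.val : ZMod 8)).val = F at h2 ⊢
        omega
      · rw [ZMod.val_add, ZMod.val_add]; omega
  have hker : ∀ p, f p = 1 → p = (0, 0, 0) := by
    rintro ⟨i, j, k⟩ h
    simp only [hf_def] at h
    rcases zmod2_cases k with rfl | rfl
    · rw [hv0, pow_zero, mul_one] at h
      rcases zmod2_cases j with rfl | rfl
      · rw [hv0, pow_zero, mul_one] at h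
        have h8 : 8 ∣ i.val := by
          have := orderOf_dvd_of_pow_eq_one h
          rwa [ha] at this
        have hi : i = 0 := by
          have := ZMod.val_lt i
          have h0 : i.val = 0 := by omega
          exact (ZMod.val_eq_zero i).1 h0
        rw [hi]
      · exfalso
        rw [hv1, pow_one] at h
        apply hu
        have hu' : u = a ^ (7 * i.val) := by
          have h2 : a ^ (7 * i.val) * (a ^ i.val * u) = a ^ (7 * i.val) := by rw [h, mul_one]
          rw [← mul_assoc, ← pow_add, hapow (7 * i.val + i.val) 0 (by omega), pow_zero, one_mul] at h2
          exact h2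
        rw [hu']
        exact Subgroup.pow_mem _ (Subgroup.mem_zpowers a) _
    · exfalso
      rw [hv1, pow_one] at h
      apply hx (7 * i.val) j.val
      -- `x = (aⁱ uʲ)⁻¹ = a^{7i} uʲ`
      have h2 : a ^ (7 * i.val) * u ^ j.val * (a ^ i.val * u ^ j.val * x) = a ^ (7 * i.val) * u ^ j.val := by
        rw [h, mul_one]
      rw [show a ^ (7 * i.val) * u ^ j.val * (a ^ i.val * u ^ j.val * x) =
          a ^ (7 * i.val) * (u ^ j.val * (a ^ i.val * (u ^ j.val * x))) by simp only [mul_assoc],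
        UA, AA, UU, hapow (7 * i.val + i.val) 0 (by omega), hupow (j.val + j.val) 0 (by omega), pow_zero, pow_zero,
        one_mul, one_mul] at h2
      exact h2
  have hfo : f (0, 0, 0) = 1 := by simp only [hf_def, hv0, ZMod.val_zero, pow_zero, mul_one]
  obtain ⟨e, he, hef⟩ := exists_table_equiv_of_words_inv mul (0, 0, 0) inv f hf hker hfo ho hlinv
    (by rw [hcard]; simp [ZMod.card])
  exact ⟨e, he, fun p => hef p⟩

end Summit.HodgeConjecture.CorCM.GaloisModels.CyclicEightTimesTwo
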